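import Mathlib
import Summits.SmoothPoincare4.SmoothPoincare4.Theorems.HyperbolicEnd.Negative.NeckDensity
import Summits.SmoothPoincare4.SmoothPoincare4.Theorems.HyperbolicEnd.Negative.CertificatePullback

/-!
# `HyperbolicEnd` (stmt-SmoothPoincare4-7825), line `Sketch`, negative side — the neck certificate along holomorphic maps

Helper for `Theorems/HyperbolicEnd/Negative/FrozenFill.lean` (frozen-J certificate filling fails
in complex dimension one). Statement registered on the crux item (stub helper_neckCertificate).

For `g` smooth on an open `U ⊆ ℂ` with `ℂ`-linear real derivative and `1 < ‖g‖ < 4` on `U`, the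
density `λ(w) = (1 + 81/‖g w‖⁴) ‖Dg(w) 1‖²` is smooth on `U` and satisfies the certificate
inequality `2 · (1/1000) · λ³ ≤ λ Δλ - |∇λ|²` there.  This is the conformal invariance of the
certificate inequality (`helper_certificatePullback`, file `Negative/CertificatePullback.lean`)
applied to the neck density `Φ₀ x = 1 + 81/‖x‖⁴` on the annulus `V = {1 < ‖x‖ < 4}` with
`c = 1/1000`, where `Φ₀` is smooth and satisfies the flat inequality (`helper_neckDensity`, file
`Negative/NeckDensity.lean`).
-/

noncomputable section

-- the prescribed namespace `Summit.<P>.<Sub>.…` duplicates `SmoothPoincare4` (P = Sub)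
set_option linter.dupNamespace false

open scoped ContDiff Topology Real
open Laplacian Set Filter Metric Complex

namespace Summit.SmoothPoincare4.SmoothPoincare4.Theorems.HyperbolicEnd.Negative

/-- helper (W-A''): **the neck certificate along holomorphic maps.**  For `g` smooth on the open
set `U` with `ℂ`-linear real derivative and `1 < ‖g‖ < 4` on `U`, the pulled-back neck density
`(1 + 81/‖g w‖⁴) ‖Dg(w) 1‖²` is smooth on `U` and satisfies `2 · 10⁻³ · λ³ ≤ λ Δλ - |∇λ|²`. -/
theorem helper_neckCertificate : ∀ (U : Set ℂ) (g : ℂ → ℂ), IsOpen U → ContDiffOn ℝ ∞ g U →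
    (∀ z ∈ U, ∀ ζ : ℂ, fderiv ℝ g z (Complex.I * ζ) = Complex.I * fderiv ℝ g z ζ) →
    (∀ z ∈ U, 1 < ‖g z‖ ∧ ‖g z‖ < 4) →
    ContDiffOn ℝ ∞ (fun w => ((1 + 81 / (‖g w‖ ^ 2) ^ 2) * ‖fderiv ℝ g w 1‖ ^ 2 : ℝ)) U ∧
      ∀ z ∈ U, 2 * (1 / 1000) * ((1 + 81 / (‖g z‖ ^ 2) ^ 2) * ‖fderiv ℝ g z 1‖ ^ 2) ^ 3 ≤
        (1 + 81 / (‖g z‖ ^ 2) ^ 2) * ‖fderiv ℝ g z 1‖ ^ 2 *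
            (Δ (fun w => ((1 + 81 / (‖g w‖ ^ 2) ^ 2) * ‖fderiv ℝ g w 1‖ ^ 2 : ℝ))) z -
          ((fderiv ℝ (fun w => ((1 + 81 / (‖g w‖ ^ 2) ^ 2) * ‖fderiv ℝ g w 1‖ ^ 2 : ℝ)) z 1) ^ 2 +
            (fderiv ℝ (fun w => ((1 + 81 / (‖g w‖ ^ 2) ^ 2) * ‖fderiv ℝ g w 1‖ ^ 2 : ℝ)) z
              Complex.I) ^ 2) := by
  intro U g hU hg hhol hann
  -- the annulus `1 < ‖x‖ < 4` is open and avoids the origin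
  have hV : IsOpen {x : ℂ | 1 < ‖x‖ ∧ ‖x‖ < 4} :=
    (isOpen_lt continuous_const continuous_norm).inter (isOpen_lt continuous_norm continuous_const)
  obtain ⟨hsmooth, hineq⟩ := helper_neckDensity
  have hΦ : ContDiffOn ℝ ∞ (fun x : ℂ => (1 + 81 / (‖x‖ ^ 2) ^ 2 : ℝ))
      {x : ℂ | 1 < ‖x‖ ∧ ‖x‖ < 4} :=
    hsmooth.mono fun x hx => norm_pos_iff.1 (lt_trans one_pos hx.1)
  exact helper_certificatePullback (fun x : ℂ => (1 + 81 / (‖x‖ ^ 2) ^ 2 : ℝ))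
    {x : ℂ | 1 < ‖x‖ ∧ ‖x‖ < 4} U g (1 / 1000) hV hU hΦ (fun x hx => hineq x hx.1 hx.2) hg hhol
    hann

end Summit.SmoothPoincare4.SmoothPoincare4.Theorems.HyperbolicEnd.Negative

end
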